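import Summits.QuantumFields.BalabanUV.Beta.D1BFx.KernelMassTotal
import Summits.QuantumFields.BalabanUV.Beta.D1BFx.GhostLegProfile
import Summits.QuantumFields.BalabanUV.Beta.D1BFx.TorusBondArrays

/-!
# `BalabanUV.Beta.D1BFx.GhostLegMasses` — road «BF-x» for binder row D1, slot (K), (II)-rows (C1)(C2), FILE γ1 «LEG-MASS ∕ GHOST LEG»: **THE SCALAR GHOST
# LEG AND ITS LAPLACIAN IN THE MASS CURRENCY** — `RowMass∕ColMass (Ggh n a) θ g` from β2's letter, the dictionary as a KERNEL IDENTITY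
# `lapU∘Ggh = (n²)⁻¹•(idK − (a∕n⁴)•sameBlk∘Ggh)`, hence `RowMass∕ColMass (lapU∘Ggh) θ ((n²)⁻¹(1 + a·e^{4nθ}·g))` — the TRUE `n⁻²`

HONEST DEPENDENCY (cell records, verbatim): «continuum YM on T⁴ ⇐ BetaPertH ∧ nine spine estimates (0/9 proved); BetaPertH ⇐ (D1) ∧ (D4) ∧
CAP+tail; G-an2-4 gates asym, D1 and NE2/3/4.»  HONEST FRAMING (cell contract, verbatim): «discharging `BetaPertH` makes Bałaban's UV stability
UNCONDITIONAL — a real constructive-QFT result; it is NOT the continuum limit and NOT the Clay problem.»  THIS MODULE DISCHARGES NOTHING of the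
wall: [folklore] bookkeeping BY NAME over the road's `GhostLeg` (`tsum_AX_mul_Ggh`, `AX_pred_apply`, `trK_Ggh`), `B6QGQLower276` (blocks), FILE α1's
calculus; the only analytic input is upstream (β2).  No definition, no `def … : Prop`, nothing cited, 0 sorry.  0 root-level binders of row D1 discharged (hW ∕ hR-sockets ∕ hSX-socket ∕ D1Tel ∕ D1Rep = 0); (K) NOT closed; (C1)(C2) NOT closed here (these are their LEG letters); NOT D1, NOT `BetaPertH`, NOT continuum, NOT Clay.

ABSOLUTE RULE (cell charter, verbatim): «No internally-minted statement may enter as a cited fact. Every hypothesis is either kernel-proved in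
this package or a verbatim quotation of a PUBLISHED theorem with page reference. The manuscript(s) under audit are NOT citable for their own
disputed steps — they are the thing under adjudication; programme-internal (2001/route/tribunal) claims are never citable.»

WHY.  Every leg of the P4b words is a polynomial in `Ggh`, `lapU`, `sameBlk`, `Pgt`; this file turns the road's entrywise dictionary
`(n²(−Δ) + a n⁻⁴·1[same block])·Ggh = 1` into the kernel identity the mass calculus composes, so that `lapU∘Ggh` costs `n⁻²` (not the `n⁰·Zl` of `decays_comp`).

CONTENT (`n ≥ 1` the block side, `a > 0`, `θ ≥ 0` where stated).
* §1 `rowFn_unit`, **`masses_Ggh`** (β2's row-sum letter IS `RowMass`, and `ColMass` by `trK_Ggh`).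
* §2 `l1_le_of_sameBlk` (`|x−r|₁ ≤ 4n` in one block), `masses_sameBlk` (`n⁴·e^{4nθ}`), **`lapU_comp_Ggh`** (the kernel identity), `masses_idK`,
  **`masses_lapU_Ggh`**: `RowMass∕ColMass (comp lapU (Ggh n a)) θ ((n²)⁻¹·(1 + a·e^{4nθ}·g))`.
NOT HERE: `Pgt ∕ Rgt` (γ2), `Cgh ∕ lapU∘Cgh` and the master letter (γ3).
Unit `b2b-balaban-gan24-formalise-leaf-05` (gen 54), G-an2-4 swarm leaf prover 05, road «BF-x» (C1)(C2) count owner (RULING ρ-g19-1 AMENDED, journal l.43347); INTENT «LEG-MASS» (journal).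
-/


noncomputable section

namespace Summit.QuantumFields.BalabanUV.Beta.D1BFx.GhostLegMasses

open scoped BigOperators
open Finset
open Literature.MathematicalPhysics.QuantumFieldTheory.Balaban1983to89
open Literature.MathematicalPhysics.QuantumFieldTheory.Balaban1983to89.Beta
open B12Sec2to5 (l1 l1_nonneg)
open ExpKernelCalculus (Site MKer comp Zl Zl_pos l1_sub_triangle l1_sub_symm summable_exp_shift tsum_exp_shift)
open HessKerSchurResolvent (idK idK_apply)
open B6QGQLower276 (X e blk B mem_B sameBlk lapKer AX dist_le_of_blk_eq)
open B5Hk103ScalarZd (Gk gq tsum_blocks summable_blocks)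
open B6QGGQ278Zd (Csq abs_Csq_le cC deltaC deltaC_pos)
open Summit.QuantumFields.BalabanUV.Beta.TameKernelCalculus (trK trK_comp trK_trK Tame Spr)
open Summit.QuantumFields.BalabanUV.Beta.D1BFx.GhostLeg (Ggh Ggh_apply Ggh_symm trK_Ggh tame_Ggh AX_pred_apply tsum_AX_mul_Ggh
  l1_sub_le_four_mul_dist)
open Summit.QuantumFields.BalabanUV.Beta.D1BFx.RProjector (Pgt Pgt_apply Pgt_symm kerP Pker summable_kerP summable_Pker)
open Summit.QuantumFields.BalabanUV.Beta.D1BFx.RJetProjector (Rgt Rgt_apply)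
open Summit.QuantumFields.BalabanUV.Beta.D1BFx.KGhostLeg (Cgh Cgh_apply)
open Summit.QuantumFields.BalabanUV.Beta.D1BFx.TorusGhostWordArrays (lapU decays_lapU)
open Summit.QuantumFields.BalabanUV.Beta.D1BFx.KernelMassCalculus
open Summit.QuantumFields.BalabanUV.Beta.D1BFx.KernelMassTotal

variable {θ : ℝ}

/-! ## §1 `Unit`-fibred kernels and the scalar ghost leg -/

/-- [folklore] For a `Unit`-fibred kernel the row profile is `|K x y|·e^{θ|x−y|₁}`. -/
theorem rowFn_unit (K : MKer 4 Unit) (θ : ℝ) (x y : Site 4) : rowFn K θ x y = |K x y () ()| * Real.exp (θ * l1 (x - y)) := by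
  unfold rowFn; simp

variable (n : ℕ) [NeZero n] {a : ℝ}

/-- [folklore] **THE GHOST LEG's MASSES FROM β2's LETTER**: a row-sum letter `∀ x, Summable ∧ Σ'_y |Ggh n a x y|·e^{θ|x−y|₁} ≤ g` IS `RowMass (Ggh n a) θ g`,
and (symmetry `trK (Ggh n a) = Ggh n a`) also `ColMass (Ggh n a) θ g`. -/
theorem masses_Ggh (ha : 0 < a) {g : ℝ} (h : ∀ x : Site 4, (Summable fun y => |Ggh n a x y () ()| * Real.exp (θ * l1 (x - y))) ∧
      ∑' y, |Ggh n a x y () ()| * Real.exp (θ * l1 (x - y)) ≤ g) :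
    RowMass (Ggh n a) θ g ∧ ColMass (Ggh n a) θ g := by
  have hR : RowMass (Ggh n a) θ g := fun x => by
    have e : rowFn (Ggh n a) θ x = fun y => |Ggh n a x y () ()| * Real.exp (θ * l1 (x - y)) := funext fun y => rowFn_unit _ θ x y
    rw [e]; exact h x
  exact ⟨hR, by rw [colMass_iff_rowMass_trK, trK_Ggh n a ha]; exact hR⟩

/-! ## §2 The same-block kernel and `lapU ∘ Ggh = n⁻²(δ − a·n⁻⁴·sameBlk ∘ Ggh)` -/

omit [NeZero n] in
/-- [folklore] Two sites of one block (side `n`) are `ℓ¹`-close: `|x − r|₁ ≤ 4n`. -/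
theorem l1_le_of_sameBlk {x r : Site 4} (h : blk (n - 1) x = blk (n - 1) r) : l1 (x - r) ≤ 4 * (n : ℝ) := by
  have h1 := l1_sub_le_four_mul_dist x r
  have h2 := dist_le_of_blk_eq (d := 4) h
  have h3 : ((n - 1 : ℕ) : ℝ) ≤ (n : ℝ) := by exact_mod_cast Nat.sub_le n 1
  linarith

/-- [folklore] **THE SAME-BLOCK KERNEL's MASSES**: `K x r := sameBlk (n−1) x r` (as a `Unit` kernel) has `RowMass∕ColMass θ (n⁴·e^{4nθ})` for `θ ≥ 0`
(`n⁴` sites per block, each at `ℓ¹`-distance `≤ 4n`). -/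
theorem masses_sameBlk (hθ : 0 ≤ θ) :
    RowMass (fun x r (_ : Unit) (_ : Unit) => sameBlk (d := 4) (n - 1) x r) θ ((n : ℝ) ^ 4 * Real.exp (4 * n * θ)) ∧
    ColMass (fun x r (_ : Unit) (_ : Unit) => sameBlk (d := 4) (n - 1) x r) θ ((n : ℝ) ^ 4 * Real.exp (4 * n * θ)) := by
  have hcard : ∀ w : Site 4, ∑ _r ∈ B (d := 4) (n - 1) w, Real.exp (4 * n * θ) = (n : ℝ) ^ 4 * Real.exp (4 * n * θ) := fun w => by
    rw [B6QGQLower276.sum_B_const, GhostLeg.cast_pred_add_one n]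
  have key : ∀ x : Site 4, (Summable fun r => rowFn (fun x r (_ : Unit) (_ : Unit) => sameBlk (d := 4) (n - 1) x r) θ x r) ∧
      ∑' r, rowFn (fun x r (_ : Unit) (_ : Unit) => sameBlk (d := 4) (n - 1) x r) θ x r ≤ (n : ℝ) ^ 4 * Real.exp (4 * n * θ) := by
    intro x
    have hsupp : ∀ r ∉ B (n - 1) (blk (n - 1) x), rowFn (fun x r (_ : Unit) (_ : Unit) => sameBlk (d := 4) (n - 1) x r) θ x r = 0 := by
      intro r hr
      rw [rowFn_unit]
      have : sameBlk (d := 4) (n - 1) x r = 0 := by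
        unfold sameBlk; rw [if_neg]; exact fun h => hr (mem_B.2 h.symm)
      rw [this, abs_zero, zero_mul]
    refine ⟨summable_of_ne_finset_zero hsupp, ?_⟩
    rw [tsum_eq_sum hsupp]
    calc ∑ r ∈ B (n - 1) (blk (n - 1) x), rowFn (fun x r (_ : Unit) (_ : Unit) => sameBlk (d := 4) (n - 1) x r) θ x r
        ≤ ∑ _r ∈ B (n - 1) (blk (n - 1) x), Real.exp (4 * n * θ) := by
          refine Finset.sum_le_sum fun r hr => ?_
          rw [rowFn_unit]
          have hb : blk (n - 1) x = blk (n - 1) r := (mem_B.1 hr).symm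
          have h1 : |sameBlk (d := 4) (n - 1) x r| ≤ 1 := by unfold sameBlk; rw [if_pos hb]; simp
          have h2 : Real.exp (θ * l1 (x - r)) ≤ Real.exp (4 * n * θ) :=
            Real.exp_le_exp.2 (by nlinarith [l1_le_of_sameBlk n hb, l1_nonneg (x - r)])
          calc |sameBlk (d := 4) (n - 1) x r| * Real.exp (θ * l1 (x - r)) ≤ 1 * Real.exp (4 * n * θ) :=
                mul_le_mul h1 h2 (Real.exp_pos _).le zero_le_one
            _ = _ := one_mul _
      _ = (n : ℝ) ^ 4 * Real.exp (4 * n * θ) := hcard _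
  refine ⟨key, ?_⟩
  rw [colMass_iff_rowMass_trK]
  have e : trK (fun x r (_ : Unit) (_ : Unit) => sameBlk (d := 4) (n - 1) x r) = fun x r (_ : Unit) (_ : Unit) => sameBlk (d := 4) (n - 1) x r := by
    funext x r u v; unfold trK sameBlk; simp only [eq_comm]
  rw [e]; exact key

/-- [folklore] **THE DICTIONARY AS A KERNEL IDENTITY**: `lapU ∘ Ggh n a = (n²)⁻¹ • (idK − (a·n⁻⁴) • (sameBlk ∘ Ggh n a))`
(`GhostLeg.tsum_AX_mul_Ggh`: `(n²(−Δ) + a n⁻⁴·1[same block])·Ggh = 1` entrywise). -/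
theorem lapU_comp_Ggh (ha : 0 < a) : comp lapU (Ggh n a) =
    ((n : ℝ) ^ 2)⁻¹ • (idK - (a / (n : ℝ) ^ 4) • comp (fun x r (_ : Unit) (_ : Unit) => sameBlk (d := 4) (n - 1) x r) (Ggh n a)) := by
  have hn : (0 : ℝ) < n := Nat.cast_pos.2 (Nat.pos_of_ne_zero (NeZero.ne n))
  funext x y u v
  have hdict := tsum_AX_mul_Ggh n a ha x y u v
  -- split the row of `AX` into its Laplacian and block parts (both finitely supported)
  have hL : ∀ r ∉ B5Hk103ScalarZd.nbhd (n - 1) x, lapKer (d := 4) x r * Ggh n a r y u v = 0 := fun r hr => by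
    rw [B5Hk103ScalarZd.lapKer_eq_zero_of_not_mem hr, zero_mul]
  have hS : ∀ r ∉ B (n - 1) (blk (n - 1) x), sameBlk (d := 4) (n - 1) x r * Ggh n a r y u v = 0 := fun r hr => by
    have : sameBlk (d := 4) (n - 1) x r = 0 := by unfold sameBlk; rw [if_neg]; exact fun h => hr (mem_B.2 h.symm)
    rw [this, zero_mul]
  have hsL : Summable fun r => lapKer (d := 4) x r * Ggh n a r y u v := summable_of_ne_finset_zero hL
  have hsS : Summable fun r => sameBlk (d := 4) (n - 1) x r * Ggh n a r y u v := summable_of_ne_finset_zero hS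
  have hsplit : ∑' r, AX (n - 1) a x r * Ggh n a r y u v
      = (n : ℝ) ^ 2 * ∑' r, lapKer (d := 4) x r * Ggh n a r y u v + a / (n : ℝ) ^ 4 * ∑' r, sameBlk (d := 4) (n - 1) x r * Ggh n a r y u v := by
    rw [← tsum_mul_left, ← tsum_mul_left, ← (hsL.mul_left _).tsum_add (hsS.mul_left _)]
    exact tsum_congr fun r => by rw [AX_pred_apply n a x r]; ring
  have ecomp : comp lapU (Ggh n a) x y u v = ∑' r, lapKer (d := 4) x r * Ggh n a r y u v := by
    unfold ExpKernelCalculus.comp lapU; simp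
  have ecompS : comp (fun x r (_ : Unit) (_ : Unit) => sameBlk (d := 4) (n - 1) x r) (Ggh n a) x y u v
      = ∑' r, sameBlk (d := 4) (n - 1) x r * Ggh n a r y u v := by
    unfold ExpKernelCalculus.comp; simp
  simp only [Pi.smul_apply, Pi.sub_apply, smul_eq_mul]
  rw [ecomp, ecompS, idK_apply]
  rw [hsplit] at hdict
  have hn2 : (n : ℝ) ^ 2 ≠ 0 := by positivity
  have hmul : (n : ℝ) ^ 2 * ∑' r, lapKer (d := 4) x r * Ggh n a r y u v
      = (if x = y then (1 : ℝ) else 0) - a / (n : ℝ) ^ 4 * ∑' r, sameBlk (d := 4) (n - 1) x r * Ggh n a r y u v := by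
    linarith [hdict]
  have : ∑' r, lapKer (d := 4) x r * Ggh n a r y u v
      = ((n : ℝ) ^ 2)⁻¹ * ((if x = y then (1 : ℝ) else 0) - a / (n : ℝ) ^ 4 * ∑' r, sameBlk (d := 4) (n - 1) x r * Ggh n a r y u v) := by
    rw [← hmul, ← mul_assoc, inv_mul_cancel₀ hn2, one_mul]
  rw [this]
  congr 2
  simp

/-- [folklore] `idK` on a `Unit` fibre has row and column mass `1` (any `θ`). -/
theorem masses_idK : RowMass (idK : MKer 4 Unit) θ 1 ∧ ColMass (idK : MKer 4 Unit) θ 1 := by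
  have key : ∀ x : Site 4, (Summable (rowFn (idK : MKer 4 Unit) θ x)) ∧ ∑' y, rowFn (idK : MKer 4 Unit) θ x y ≤ 1 := by
    intro x
    have hsupp : ∀ y ∉ ({x} : Finset (Site 4)), rowFn (idK : MKer 4 Unit) θ x y = 0 := fun y hy => by
      rw [rowFn_unit, idK_apply, if_neg, abs_zero, zero_mul]
      exact fun h => hy (Finset.mem_singleton.2 h.1.symm)
    refine ⟨summable_of_ne_finset_zero hsupp, ?_⟩
    rw [tsum_eq_sum hsupp, Finset.sum_singleton, rowFn_unit, idK_apply, if_pos ⟨rfl, rfl⟩, sub_self]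
    simp [l1]
  refine ⟨key, ?_⟩
  rw [colMass_iff_rowMass_trK]
  have e : trK (idK : MKer 4 Unit) = idK := by
    funext x y u v; unfold trK; rw [idK_apply, idK_apply]; simp [eq_comm]
  rw [e]; exact key

/-- [folklore] **THE MASSES OF `lapU ∘ Ggh`**: `RowMass∕ColMass θ ((n²)⁻¹·(1 + a·e^{4nθ}·g))` from `RowMass∕ColMass (Ggh n a) θ g` (`θ ≥ 0`) —
the dictionary's `n⁻²`, NOT the `n⁰·Zl` of `decays_lapU ∘ decays_Ggh`. -/
theorem masses_lapU_Ggh (ha : 0 < a) (hθ : 0 ≤ θ) {g : ℝ} (hG : RowMass (Ggh n a) θ g ∧ ColMass (Ggh n a) θ g) :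
    RowMass (comp lapU (Ggh n a)) θ (((n : ℝ) ^ 2)⁻¹ * (1 + a * Real.exp (4 * n * θ) * g)) ∧
    ColMass (comp lapU (Ggh n a)) θ (((n : ℝ) ^ 2)⁻¹ * (1 + a * Real.exp (4 * n * θ) * g)) := by
  have hn : (0 : ℝ) < n := Nat.cast_pos.2 (Nat.pos_of_ne_zero (NeZero.ne n))
  obtain ⟨hSr, hSc⟩ := masses_sameBlk n hθ
  have hRc : RowMass (comp (fun x r (_ : Unit) (_ : Unit) => sameBlk (d := 4) (n - 1) x r) (Ggh n a)) θ ((n : ℝ) ^ 4 * Real.exp (4 * n * θ) * g) :=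
    rowMass_comp hSr hG.1 hθ
  have hCc : ColMass (comp (fun x r (_ : Unit) (_ : Unit) => sameBlk (d := 4) (n - 1) x r) (Ggh n a)) θ ((n : ℝ) ^ 4 * Real.exp (4 * n * θ) * g) :=
    colMass_comp hSc hG.2 hθ
  have e : ((n : ℝ) ^ 2)⁻¹ * (1 + a * Real.exp (4 * n * θ) * g)
      = |((n : ℝ) ^ 2)⁻¹| * (1 + |(a / (n : ℝ) ^ 4)| * ((n : ℝ) ^ 4 * Real.exp (4 * n * θ) * g)) := by
    rw [abs_of_pos (by positivity), abs_of_pos (by positivity)]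
    field_simp
  rw [lapU_comp_Ggh n ha, e]
  exact ⟨(masses_idK.1.sub (hRc.smul _)).smul _, (masses_idK.2.sub (hCc.smul _)).smul _⟩

end Summit.QuantumFields.BalabanUV.Beta.D1BFx.GhostLegMasses

end
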